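import Literature.MathematicalPhysics.QuantumFieldTheory.Balaban1983to89.B9Ineq347SiteReadingY
import Literature.MathematicalPhysics.QuantumFieldTheory.Balaban1983to89.B9Ineq347GAAtLetters
import Literature.MathematicalPhysics.QuantumFieldTheory.Balaban1983to89.B9CubeLettersInvReadDictB
import Literature.MathematicalPhysics.QuantumFieldTheory.Balaban1983to89.B9CoReadingCoords

/-!
# `Balaban1983to89.B9Ineq347BondReadingY` — B9 p. 398 «the global inequalities (3.47) are consequences of the local ones (3.42) and Lemma 2.1»
# FOR NODE 00's BOND-SECTOR READING `kernelFamilyB` (Thm 3.3's `G(U)` and every bond letter) AT A MEMBER WITH A SECTION OF `β`, AT EVERY CONFIGURATION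
# — the bond-sector twin of `B9Ineq347SiteReadingY`

T. Bałaban, *Propagators for lattice gauge theories in a background field*, Commun. Math. Phys. **99** (1985) 389–434
[`Balaban1985BackgroundPropagators`, "B9"], (3.41)–(3.42) p. 397, (3.47) p. 398, Thm 3.3 p. 399; T. Bałaban, *Propagators and renormalization
transformations for lattice gauge theories. II*, Commun. Math. Phys. **96** (1984) 223–250 [`Balaban1984PropagatorsII`, "[4]"], (2.52) p. 232, Lemma 2.1
(2.60)–(2.61) p. 234.

statement-level skeleton of published theorems with citation tags; proofs where landed; nothing here is a claim about the Yang–Mills mass gap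

THE PRINTED SENTENCE (p. 398): *«It is easy to see that the global inequalities (3.47) are consequences of the local ones (3.42) and Lemma 2.1.»* (Thm 3.3
p. 399: *«the same statements hold for the operators G(U)»* — bond arguments `J`).  The tree's kernel-checked form, `B9Ineq347Reading.globBlockOn_of_eBlock`
(n06-h), is CONDITIONAL on the reading axioms `GlobReading K P U res`.  `B9Ineq347SiteReadingY` (this lineage, gen 8) discharged them for NODE 00's SITE-sector
reading `kernelFamilyS`; THIS FILE is the word-for-word twin for the BOND-sector reading `Node00.kernelFamilyB i B cfg O par` — ANY backgrounds record `B`,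
ANY decoding `cfg`, ANY bond operator `O` (so for `G(U)`, `𝔾_D`, `G₁`, `𝔾`, `G(Ω) − G(Ω′)` alike), ANY transporter `par`, AT ANY configuration — at a member
carrying a SECTION `ιB` of `β`.  Use (pub-ymgap N06 row 13, G side, seat dag-n06-c gen 13): the (3.47) member of the Sect.-B output `G(U′U)` read by
`KACU` at the coded product, from its (3.42) block there (`B9SectBGStepCodedF`, Route F) — the global member needs no letters of its own.

WHAT IS IN THE FILE (0 sorry; standard axioms; three small `def`s = the block pieces and the inner reading vector).
* §1 `pieceB ιB b J` (the piece of a fine-bond function on the block labelled `b`), `resB` (on the sum-typed arguments: bond functions cut, site functions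
  untouched — the bond reading is `0` on them), `sum_pieceB`, `suppIn_pieceB`, `supNorm_pieceB_le` (|Δ(y′)J| ≦ (L^{j′}η)^γ|J|_{(γ)}).
* §2 `eInB` (the four inner (3.42) readings `[sup_Δ‖OΛ‖, sup_ν sup_Δ‖∇_νOΛ‖, sup_ν sup_Δ‖O∇*_νΛ‖, sup_Δ‖Δ_UOΛ‖]_n` of def-Y's `kernelFamilyB`, `rfl`),
  sub-additivity along finite sums (`supInB_sum_le`, `eInB_sum_le`), the uniform bound over the unit ball (`exists_ball_bound_eInB`), ★ `e_subadd_kernelFamilyB`.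
* §3 ★ `glob_le_kernelFamilyB` («the smallest number C such that …», p21's `wNormBY_le_of_pointwise`).
* §4 ★★ `globReading_kernelFamilyB` — `GlobReading (kernelFamilyB …) (bond arguments) c (resB ιB)`; ★★ `globBlock_kernelFamilyB_of_eBlock` — for every rate
  `δ₀ > 0` ONE threshold `Mg` and ONE constant `Cg ≥ 0` such that at every member with a section above `Mg`: `EBlock (kernelFamilyB …) B₀ δ₀ c → GlobBlock
  (kernelFamilyB …) (B₀·Cg) c`, every `B c cfg O par`, `B₀ ≥ 0`.

HONEST SCOPE.  Print's «easy to see» bookkeeping for one concrete reading; the analytic input is [4] Lemma 2.1 as supplied in the tree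
(`B9RWSums347DefiniteFacesWindow.lemma21Window_geo9Y`).  Nothing of Theorem 3.3 is asserted (the (3.42) block is the HYPOTHESIS); per-member, under the
section hypothesis `hι`.  COUNT-NEUTRAL; N06 NOT discharged; one finite lattice programme — nothing continuum ∕ OS ∕ mass-gap ∕ Clay.  No `sorry`, no `axiom`,
no `instance`, no `notation`.  Cell `pub-ymgap` (HUMAN RULING D-0062), Track A node N06 [B9], row 13, seat dag-n06-c g13, 2026-08-28; `--supports stmt-QuantumFields-27364`.

RELATED IN THE TREE, NOT DUPLICATED: `B9Ineq347SiteReadingY` (the site twin — TEMPLATE, its generic pieces not restated: different carrier), `B9Ineq347Reading`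
(`GlobReading`, `globBlockOn_of_eBlock` — USED), `B9Ineq347GAAtLetters` ((3.47) for G(1) from [4] (2.136) directly; `wNormBY_le_of_pointwise` USED),
`B9Ineq347CoReadingAtLetters` (the co-reading route through a dominating scalar model — a different currency), `B9CubeLettersInvReadDictB` (`supInB` API — USED),
`B9CoReadingCoords` (`cdBₗ ∕ cdsBₗ ∕ lapBₗ` — USED).
-/

noncomputable section

namespace Literature.MathematicalPhysics.QuantumFieldTheory.Balaban1983to89.B9Ineq347BondReadingY

open Literature.MathematicalPhysics.QuantumFieldTheory.Balaban1983to89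
open Literature.MathematicalPhysics.QuantumFieldTheory.Balaban1983to89.B6KLevelCensusIndexV1 (KIdx kGeo)
open Literature.MathematicalPhysics.QuantumFieldTheory.Balaban1983to89.B6Ineq2142KLevelV1 (β lvl beta_level)
open Literature.MathematicalPhysics.QuantumFieldTheory.Balaban1983to89.B6GlobalChartV1 (blkV1)
open Literature.MathematicalPhysics.QuantumFieldTheory.Balaban1983to89.B6RandomWalk (Ineq260 Ineq261)
open Literature.MathematicalPhysics.QuantumFieldTheory.Balaban1983to89.B9Thm34Ext (toB6)
open Literature.MathematicalPhysics.QuantumFieldTheory.Balaban1983to89.B9FromB6 (EBlock GlobBlock)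
open Literature.MathematicalPhysics.QuantumFieldTheory.Balaban1983to89.B9ResidualEntriesAtOne (GlobBlockOn)
open Literature.MathematicalPhysics.QuantumFieldTheory.Balaban1983to89.B9Ineq347Reading (GlobReading globBlockOn_of_eBlock)
open Literature.MathematicalPhysics.QuantumFieldTheory.Balaban1983to89.B9PinMembersKLevelV1 (MemberY geo9Y)
open Literature.MathematicalPhysics.QuantumFieldTheory.Balaban1983to89.B9Thm314WholeExpansionReads (le_iSup_ball)
open Literature.MathematicalPhysics.QuantumFieldTheory.Balaban1983to89.B9CubeLettersInvReadDictB (norm_le_supInB supInB_le supInB_nonneg le_iSup_fin)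
open Literature.MathematicalPhysics.QuantumFieldTheory.Balaban1983to89.B9CoReadingCoords (cdBₗ cdsBₗ lapBₗ cdBₗ_apply cdsBₗ_apply lapBₗ_apply)
open Literature.MathematicalPhysics.QuantumFieldTheory.Balaban1983to89.B9Ineq347GAAtLetters (wNormBY_le_of_pointwise)
open Literature.MathematicalPhysics.QuantumFieldTheory.Balaban1983to89.B9RWSums347DefiniteFacesWindow (lemma21Window_geo9Y)
open Literature.MathematicalPhysics.QuantumFieldTheory.Balaban1983to89.B9GeoLemma21KLevelV1 (geo9Y_len_pos geo9K_eta_pos geo9K_one_le_L)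
open Literature.MathematicalPhysics.QuantumFieldTheory.Balaban1983to89.B9GeoNormsKLevelV1 (wNormB wNormB_nonneg abs_le_of_wNormB_le geo9K_wNorm_nonneg)
open Literature.MathematicalPhysics.QuantumFieldTheory.Balaban1983to89.Node00 (SiteY BlkY FBondY IBondY CfgY KLoc BallY BondOpY BondParY liftY liftY_apply supInB
  cdB cdsB lapB wNormBY kernelFamilyB)
open Literature.MathematicalPhysics.QuantumFieldTheory.Balaban1983to89.Node00 (liftY_add)

variable {𝔸 : Type} [NormedRing 𝔸] [NormedAlgebra ℂ 𝔸] [CompleteSpace 𝔸] [FiniteDimensional ℝ 𝔸]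
variable {d ℓ : ℕ} {hd : 1 ≤ d + 1} {hL : Odd (ℓ + 1) ∧ 1 < ℓ + 1} {b₀ b₁ : ℝ} {Mstar : ℕ}

/-! ## §1 Block pieces of a bond argument -/

section Pieces

variable (x : MemberY d ℓ hd hL b₀ b₁ Mstar) (ιB : BlkY x.toKIdx → IBondY x.toKIdx)

open Classical in
/-- **THE BLOCK PIECE `Δ(y′)J`** of a fine-bond function: `J` on the fine bonds whose block is labelled `b` (`ιB (blkV1 e) = b`), `0` elsewhere.
[cite: Balaban1984PropagatorsII, (2.52) p.232] -/
def pieceB (b : IBondY x.toKIdx) (J : FBondY x.toKIdx → ℝ) : FBondY x.toKIdx → ℝ := fun e => if ιB (blkV1 x.hN x.D e) = b then J e else 0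

/-- **THE BLOCK PIECES ON THE SUM-TYPED ARGUMENTS** (bond functions cut to the block; site functions untouched — they are not read by the bond sector).
[cite: Balaban1984PropagatorsII, (2.52) p.232; Balaban1985BackgroundPropagators, (3.42) p.397 («supp λ ⊂ Δ(y′)»)] -/
def resB (b : IBondY x.toKIdx) : KLoc x.toKIdx → KLoc x.toKIdx
  | .inl f => .inl f
  | .inr J => .inr (pieceB x ιB b J)

omit [NormedAlgebra ℂ 𝔸] [CompleteSpace 𝔸] [FiniteDimensional ℝ 𝔸] in
/-- the piece vanishes off its block. [cite: Balaban1984PropagatorsII, (2.52) p.232, bookkeeping] -/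
theorem pieceB_off {b : IBondY x.toKIdx} {J : FBondY x.toKIdx → ℝ} {e : FBondY x.toKIdx} (h : ιB (blkV1 x.hN x.D e) ≠ b) : pieceB x ιB b J e = 0 := by
  classical
  exact if_neg h

omit [NormedAlgebra ℂ 𝔸] [CompleteSpace 𝔸] [FiniteDimensional ℝ 𝔸] in
/-- the piece on its block is the function. [cite: Balaban1984PropagatorsII, (2.52) p.232, bookkeeping] -/
theorem pieceB_on {b : IBondY x.toKIdx} {J : FBondY x.toKIdx → ℝ} {e : FBondY x.toKIdx} (h : ιB (blkV1 x.hN x.D e) = b) : pieceB x ιB b J e = J e := by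
  classical
  exact if_pos h

omit [NormedAlgebra ℂ 𝔸] [CompleteSpace 𝔸] [FiniteDimensional ℝ 𝔸] in
/-- the pieces are pointwise dominated by the function. [cite: Balaban1984PropagatorsII, (2.52) p.232, bookkeeping] -/
theorem abs_pieceB_le (b : IBondY x.toKIdx) (J : FBondY x.toKIdx → ℝ) (e : FBondY x.toKIdx) : |pieceB x ιB b J e| ≤ |J e| := by
  classical
  unfold pieceB
  split_ifs
  · exact le_rfl
  · rw [abs_zero]; exact abs_nonneg _

omit [NormedAlgebra ℂ 𝔸] [CompleteSpace 𝔸] [FiniteDimensional ℝ 𝔸] in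
/-- **J = Σ_{y′} Δ(y′)J** over the labels (each fine bond lies in exactly one labelled block). [cite: Balaban1984PropagatorsII, (2.52) p.232] -/
theorem sum_pieceB [inst : Fintype (geo9Y x).Site] (J : FBondY x.toKIdx → ℝ) : ∑ b : (geo9Y x).Site, pieceB x ιB b J = J := by
  classical
  funext e
  rw [Finset.sum_apply]
  exact (Finset.sum_eq_single (ιB (blkV1 x.hN x.D e) : (geo9Y x).Site) (fun b _ hb => pieceB_off x ιB (Ne.symm hb))
    (fun h => absurd (@Finset.mem_univ _ inst _) h)).trans (pieceB_on x ιB rfl)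

omit [FiniteDimensional ℝ 𝔸] in
/-- **supp Δ(y′)J ⊂ Δ(y′)** in the reading's sense (the labelling is a section of `β`). [cite: Balaban1985BackgroundPropagators, (3.42) p.397 («supp λ ⊂ Δ(y′)»)] -/
theorem suppIn_pieceB [Fintype (geo9Y x).Site] (hι : ∀ s : BlkY x.toKIdx, β x.toKIdx.hN x.toKIdx.D x.toKIdx.hk (ιB s) = s) (b : IBondY x.toKIdx)
    (J : FBondY x.toKIdx → ℝ) : (geo9Y x).suppIn (.inr (pieceB x ιB b J)) b := by
  show ∀ e : FBondY x.toKIdx, pieceB x ιB b J e ≠ 0 → blkV1 x.hN x.D e = β x.toKIdx.hN x.toKIdx.D x.toKIdx.hk b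
  intro e he
  by_cases h : ιB (blkV1 x.hN x.D e) = b
  · rw [← h, hι]
  · exact absurd (pieceB_off x ιB h) he

omit [NormedRing 𝔸] [NormedAlgebra ℂ 𝔸] [CompleteSpace 𝔸] [FiniteDimensional ℝ 𝔸] in
/-- the length of the labelled block of a fine bond is the printed scale `L^{j(e)}η`. [cite: Balaban1985BackgroundPropagators, (3.41) p.397 («Lʲη»), dictionary] -/
theorem len_blkB_eq (hι : ∀ s : BlkY x.toKIdx, β x.toKIdx.hN x.toKIdx.D x.toKIdx.hk (ιB s) = s) (e : FBondY x.toKIdx) :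
    (geo9Y x).len (ιB (blkV1 x.hN x.D e)) = ((ℓ : ℝ) + 1) ^ ((blkV1 x.hN x.D e).1.1) * |x.cf|⁻¹ := by
  have hk1 : 1 ≤ x.k := le_trans one_le_two x.hk2
  show (kGeo x.toKIdx).L ^ lvl x.hN x.D x.hk (ιB (blkV1 x.hN x.D e)) * (kGeo x.toKIdx).eta = _
  rw [← beta_level x.hN x.D x.hk hk1, hι]
  push_cast
  rfl

omit [FiniteDimensional ℝ 𝔸] in
/-- **|Δ(y′)J| ≦ (L^{j′}η)^γ·|J|_{(γ)}** (the sentence after (3.41)). [cite: Balaban1985BackgroundPropagators, (3.41) p.397] -/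
theorem supNorm_pieceB_le [Fintype (geo9Y x).Site] (hι : ∀ s : BlkY x.toKIdx, β x.toKIdx.hN x.toKIdx.D x.toKIdx.hk (ιB s) = s) (b : IBondY x.toKIdx)
    (J : FBondY x.toKIdx → ℝ) (γ : ℝ) :
    (geo9Y x).supNorm (.inr (pieceB x ιB b J)) ≤ (geo9Y x).len b ^ γ * (geo9Y x).wNorm γ (.inr J) := by
  show (⨆ e : FBondY x.toKIdx, |pieceB x ιB b J e|) ≤ (geo9Y x).len b ^ γ * wNormB x.toKIdx γ J
  have hw : 0 ≤ wNormB x.toKIdx γ J := wNormB_nonneg x.toKIdx γ J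
  have hlen : 0 ≤ (geo9Y x).len b := (geo9Y_len_pos x b).le
  refine Real.iSup_le (fun e => ?_) (mul_nonneg (Real.rpow_nonneg hlen γ) hw)
  by_cases he : ιB (blkV1 x.hN x.D e) = b
  · rw [pieceB_on x ιB he]
    have h := abs_le_of_wNormB_le x.toKIdx (le_refl (wNormB x.toKIdx γ J)) e
    rw [← he, len_blkB_eq x ιB hι e, mul_comm]
    push_cast at h
    exact h
  · rw [pieceB_off x ιB he, abs_zero]
    exact mul_nonneg (Real.rpow_nonneg hlen γ) hw

end Pieces

/-! ## §2 The inner (3.42) readings of the bond sector and their sub-additivity along finite sums -/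

section Subadd

variable (x : MemberY d ℓ hd hL b₀ b₁ Mstar)

/-- **the four inner (3.42) readings of def-Y's bond reading** at a block `s`: `[sup_{Δ(s)}‖OΛ‖, sup_ν sup_{Δ(s)}‖∇_{U,ν}OΛ‖, sup_ν sup_{Δ(s)}‖O∇*_{U,ν}Λ‖,
sup_{Δ(s)}‖Δ_U OΛ‖]_n` (so that `(kernelFamilyB …).e n c (.inr J) y = sup_E eInB (β y) n` at `Λ = J ⊗ E`, `rfl`). [cite: Balaban1985BackgroundPropagators, Thm 3.3 p.399 with (3.42) p.397] -/
def eInB (O : BondOpY 𝔸 x.toKIdx) (U : CfgY 𝔸 x.toKIdx) (Λ : FBondY x.toKIdx → 𝔸) (s : BlkY x.toKIdx) (n : Fin 4) : ℝ :=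
  (![supInB x.toKIdx s (O U Λ), ⨆ ν : Fin (d + 1), supInB x.toKIdx s (cdB x.toKIdx U ν (O U Λ)),
      ⨆ ν : Fin (d + 1), supInB x.toKIdx s (O U (cdsB x.toKIdx U ν Λ)), supInB x.toKIdx s (lapB x.toKIdx U (O U Λ))] : Fin 4 → ℝ) n

omit [FiniteDimensional ℝ 𝔸] in
/-- the (3.42) reading of `kernelFamilyB` on a bond argument IS the sup over the unit ball of the inner readings. [cite: Balaban1985BackgroundPropagators, Thm 3.3 p.399, bookkeeping] -/
theorem kernelFamilyB_e_inr (B : B9.Backgrounds) (cfg : B.Cfg → CfgY 𝔸 x.toKIdx) (O : BondOpY 𝔸 x.toKIdx) (par : BondParY 𝔸 x.toKIdx) (n : Fin 4) (c : B.Cfg)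
    (J : FBondY x.toKIdx → ℝ) (y : IBondY x.toKIdx) :
    (kernelFamilyB x.toKIdx B cfg O par).e n c (.inr J) y =
      ⨆ E : BallY 𝔸, eInB x O (cfg c) (liftY J (E : 𝔸)) (β x.toKIdx.hN x.toKIdx.D x.toKIdx.hk y) n := by
  match n with
  | 0 => rfl
  | 1 => rfl
  | 2 => rfl
  | 3 => rfl

omit [NormedAlgebra ℂ 𝔸] [CompleteSpace 𝔸] [FiniteDimensional ℝ 𝔸] in
/-- **the block sup is sub-additive along finite sums.** [cite: Balaban1985BackgroundPropagators, (3.42) p.397; Balaban1984PropagatorsII, (2.52) p.232] -/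
theorem supInB_sum_le {β' : Type} (S : Finset β') (s : BlkY x.toKIdx) (Ψ : β' → FBondY x.toKIdx → 𝔸) :
    supInB x.toKIdx s (∑ b ∈ S, Ψ b) ≤ ∑ b ∈ S, supInB x.toKIdx s (Ψ b) := by
  refine supInB_le x.toKIdx s _ (Finset.sum_nonneg fun b _ => supInB_nonneg x.toKIdx s (Ψ b)) fun e he => ?_
  rw [Finset.sum_apply]
  exact (norm_sum_le _ _).trans (Finset.sum_le_sum fun b _ => norm_le_supInB x.toKIdx s (Ψ b) he)

omit [NormedAlgebra ℂ 𝔸] [CompleteSpace 𝔸] [FiniteDimensional ℝ 𝔸] in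
/-- a directional sup of block sups is sub-additive along finite sums. [cite: Balaban1985BackgroundPropagators, (3.42) p.397; Balaban1984PropagatorsII, (2.52) p.232] -/
theorem iSup_supInB_sum_le {β' : Type} (S : Finset β') (s : BlkY x.toKIdx) (Ψ : β' → Fin (d + 1) → FBondY x.toKIdx → 𝔸) :
    (⨆ ν : Fin (d + 1), supInB x.toKIdx s (∑ b ∈ S, Ψ b ν)) ≤ ∑ b ∈ S, ⨆ ν : Fin (d + 1), supInB x.toKIdx s (Ψ b ν) := by
  refine Real.iSup_le (fun ν => ?_) (Finset.sum_nonneg fun b _ => Real.iSup_nonneg fun ν => supInB_nonneg x.toKIdx s _)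
  refine (supInB_sum_le x S s (fun b => Ψ b ν)).trans (Finset.sum_le_sum fun b _ => ?_)
  exact le_iSup_fin (fun ν' => supInB x.toKIdx s (Ψ b ν')) ν

omit [FiniteDimensional ℝ 𝔸] in
/-- **THE FOUR INNER READINGS ARE SUB-ADDITIVE ALONG FINITE SUMS OF ARGUMENTS** (linearity of `O(U)`, `∇_U`, `∇*_U`, `Δ_U` and of the block sups).
[cite: Balaban1985BackgroundPropagators, (3.42) p.397; Balaban1984PropagatorsII, (2.52) p.232] -/
theorem eInB_sum_le {β' : Type} (S : Finset β') (O : BondOpY 𝔸 x.toKIdx) (U : CfgY 𝔸 x.toKIdx) (Λ : β' → FBondY x.toKIdx → 𝔸)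
    (s : BlkY x.toKIdx) (n : Fin 4) :
    eInB x O U (∑ b ∈ S, Λ b) s n ≤ ∑ b ∈ S, eInB x O U (Λ b) s n := by
  have hO : O U (∑ b ∈ S, Λ b) = ∑ b ∈ S, O U (Λ b) := map_sum _ _ _
  match n with
  | 0 =>
    show supInB x.toKIdx s (O U (∑ b ∈ S, Λ b)) ≤ ∑ b ∈ S, supInB x.toKIdx s (O U (Λ b))
    rw [hO]
    exact supInB_sum_le x S s _
  | 1 =>
    show (⨆ ν : Fin (d + 1), supInB x.toKIdx s (cdB x.toKIdx U ν (O U (∑ b ∈ S, Λ b)))) ≤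
      ∑ b ∈ S, ⨆ ν : Fin (d + 1), supInB x.toKIdx s (cdB x.toKIdx U ν (O U (Λ b)))
    have h : ∀ ν, cdB x.toKIdx U ν (O U (∑ b ∈ S, Λ b)) = ∑ b ∈ S, cdB x.toKIdx U ν (O U (Λ b)) := fun ν => by
      rw [hO, ← cdBₗ_apply, map_sum]
      simp only [cdBₗ_apply]
    simp only [h]
    exact iSup_supInB_sum_le x S s (fun b ν => cdB x.toKIdx U ν (O U (Λ b)))
  | 2 =>
    show (⨆ ν : Fin (d + 1), supInB x.toKIdx s (O U (cdsB x.toKIdx U ν (∑ b ∈ S, Λ b)))) ≤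
      ∑ b ∈ S, ⨆ ν : Fin (d + 1), supInB x.toKIdx s (O U (cdsB x.toKIdx U ν (Λ b)))
    have h : ∀ ν, O U (cdsB x.toKIdx U ν (∑ b ∈ S, Λ b)) = ∑ b ∈ S, O U (cdsB x.toKIdx U ν (Λ b)) := fun ν => by
      rw [← cdsBₗ_apply, map_sum, map_sum]
      simp only [cdsBₗ_apply]
    simp only [h]
    exact iSup_supInB_sum_le x S s (fun b ν => O U (cdsB x.toKIdx U ν (Λ b)))
  | 3 =>
    show supInB x.toKIdx s (lapB x.toKIdx U (O U (∑ b ∈ S, Λ b))) ≤ ∑ b ∈ S, supInB x.toKIdx s (lapB x.toKIdx U (O U (Λ b)))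
    have h : lapB x.toKIdx U (O U (∑ b ∈ S, Λ b)) = ∑ b ∈ S, lapB x.toKIdx U (O U (Λ b)) := by
      rw [hO, ← lapBₗ_apply, map_sum]
      simp only [lapBₗ_apply]
    rw [h]
    exact supInB_sum_le x S s _

/-- a uniform bound over the unit ball for an ℝ-linear image of `J ⊗ E` (finite dimension). [cite: Balaban1985BackgroundPropagators, (3.42) p.397, bookkeeping] -/
theorem exists_ball_boundB (T : (FBondY x.toKIdx → 𝔸) →ₗ[ℝ] (FBondY x.toKIdx → 𝔸)) (J : FBondY x.toKIdx → ℝ) :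
    ∃ C : ℝ, 0 ≤ C ∧ ∀ (E : BallY 𝔸) (e : FBondY x.toKIdx), ‖T (liftY J (E : 𝔸)) e‖ ≤ C := by
  refine ⟨‖LinearMap.toContinuousLinearMap T‖ * ‖J‖, mul_nonneg (ContinuousLinearMap.opNorm_nonneg _) (norm_nonneg _), fun E e => ?_⟩
  have hE : ‖(E : 𝔸)‖ ≤ 1 := mem_closedBall_zero_iff.1 E.2
  have hlift : ‖liftY J (E : 𝔸)‖ ≤ ‖J‖ := by
    refine (pi_norm_le_iff_of_nonneg (norm_nonneg J)).2 fun w => ?_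
    rw [liftY_apply, norm_smul, Complex.norm_real]
    exact (mul_le_mul (norm_le_pi_norm J w) hE (norm_nonneg _) (norm_nonneg _)).trans (by rw [mul_one])
  calc ‖T (liftY J (E : 𝔸)) e‖ ≤ ‖T (liftY J (E : 𝔸))‖ := norm_le_pi_norm _ e
    _ = ‖LinearMap.toContinuousLinearMap T (liftY J (E : 𝔸))‖ := rfl
    _ ≤ ‖LinearMap.toContinuousLinearMap T‖ * ‖liftY J (E : 𝔸)‖ := ContinuousLinearMap.le_opNorm _ _
    _ ≤ ‖LinearMap.toContinuousLinearMap T‖ * ‖J‖ := mul_le_mul_of_nonneg_left hlift (ContinuousLinearMap.opNorm_nonneg _)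

/-- the four inner readings of `O(U)(J ⊗ E)` are bounded uniformly over the unit ball. [cite: Balaban1985BackgroundPropagators, (3.42) p.397, bookkeeping] -/
theorem exists_ball_bound_eInB (O : BondOpY 𝔸 x.toKIdx) (U : CfgY 𝔸 x.toKIdx) (J : FBondY x.toKIdx → ℝ) (s : BlkY x.toKIdx) (n : Fin 4) :
    ∃ C : ℝ, ∀ E : BallY 𝔸, eInB x O U (liftY J (E : 𝔸)) s n ≤ C := by
  obtain ⟨C₀, hC₀, h₀⟩ := exists_ball_boundB x ((O U).restrictScalars ℝ) J
  have hL : ∀ ν, ∃ C, 0 ≤ C ∧ ∀ (E : BallY 𝔸) e, ‖cdB x.toKIdx U ν (O U (liftY J (E : 𝔸))) e‖ ≤ C := fun ν => by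
    obtain ⟨C, hC, h⟩ := exists_ball_boundB x (cdBₗ x.toKIdx U ν ∘ₗ (O U).restrictScalars ℝ) J
    exact ⟨C, hC, fun E e => by simpa [cdBₗ_apply] using h E e⟩
  have hRs : ∀ ν, ∃ C, 0 ≤ C ∧ ∀ (E : BallY 𝔸) e, ‖O U (cdsB x.toKIdx U ν (liftY J (E : 𝔸))) e‖ ≤ C := fun ν => by
    obtain ⟨C, hC, h⟩ := exists_ball_boundB x ((O U).restrictScalars ℝ ∘ₗ cdsBₗ x.toKIdx U ν) J
    exact ⟨C, hC, fun E e => by simpa [cdsBₗ_apply] using h E e⟩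
  have hΔ : ∃ C, 0 ≤ C ∧ ∀ (E : BallY 𝔸) e, ‖lapB x.toKIdx U (O U (liftY J (E : 𝔸))) e‖ ≤ C := by
    obtain ⟨C, hC, h⟩ := exists_ball_boundB x (lapBₗ x.toKIdx U ∘ₗ (O U).restrictScalars ℝ) J
    exact ⟨C, hC, fun E e => by simpa [lapBₗ_apply] using h E e⟩
  choose CL hCL0 hCL using hL
  choose CRs hCRs0 hCRs using hRs
  obtain ⟨CΔ, hCΔ0, hCΔ⟩ := hΔ
  have hsumL : ∀ ν, CL ν ≤ ∑ μ, CL μ := fun ν => Finset.single_le_sum (fun μ _ => hCL0 μ) (Finset.mem_univ ν)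
  have hsumRs : ∀ ν, CRs ν ≤ ∑ μ, CRs μ := fun ν => Finset.single_le_sum (fun μ _ => hCRs0 μ) (Finset.mem_univ ν)
  match n with
  | 0 => exact ⟨C₀, fun E => supInB_le x.toKIdx s _ hC₀ fun e _ => h₀ E e⟩
  | 1 =>
    refine ⟨∑ μ, CL μ, fun E => Real.iSup_le (fun ν => ?_) (Finset.sum_nonneg fun μ _ => hCL0 μ)⟩
    exact supInB_le x.toKIdx s _ (Finset.sum_nonneg fun μ _ => hCL0 μ) fun e _ => (hCL ν E e).trans (hsumL ν)
  | 2 =>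
    refine ⟨∑ μ, CRs μ, fun E => Real.iSup_le (fun ν => ?_) (Finset.sum_nonneg fun μ _ => hCRs0 μ)⟩
    exact supInB_le x.toKIdx s _ (Finset.sum_nonneg fun μ _ => hCRs0 μ) fun e _ => (hCRs ν E e).trans (hsumRs ν)
  | 3 => exact ⟨CΔ, fun E => supInB_le x.toKIdx s _ hCΔ0 fun e _ => hCΔ E e⟩

omit [FiniteDimensional ℝ 𝔸] in
/-- the four inner readings are nonnegative. [cite: Balaban1985BackgroundPropagators, (3.42) p.397, bookkeeping] -/
theorem eInB_nonneg (O : BondOpY 𝔸 x.toKIdx) (U : CfgY 𝔸 x.toKIdx) (Λ : FBondY x.toKIdx → 𝔸) (s : BlkY x.toKIdx) (n : Fin 4) :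
    0 ≤ eInB x O U Λ s n := by
  match n with
  | 0 => exact supInB_nonneg x.toKIdx s (O U Λ)
  | 1 => exact Real.iSup_nonneg fun ν => supInB_nonneg x.toKIdx s _
  | 2 => exact Real.iSup_nonneg fun ν => supInB_nonneg x.toKIdx s _
  | 3 => exact supInB_nonneg x.toKIdx s (lapB x.toKIdx U (O U Λ))

omit [CompleteSpace 𝔸] [FiniteDimensional ℝ 𝔸] in
/-- the amplitude lift is additive along finite sums: `(Σ_b J_b) ⊗ E = Σ_b (J_b ⊗ E)`. [cite: Balaban1985BackgroundPropagators, (3.39) p.397, bookkeeping] -/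
theorem liftY_sumB {β' : Type} (S : Finset β') (J : β' → FBondY x.toKIdx → ℝ) (E : 𝔸) :
    liftY (∑ b ∈ S, J b) E = ∑ b ∈ S, liftY (J b) E := by
  classical
  induction S using Finset.induction_on with
  | empty =>
    funext z
    simp [liftY_apply]
  | insert a S ha ih =>
    rw [Finset.sum_insert ha, Finset.sum_insert ha, liftY_add, ih]

/-- ★ **SUB-ADDITIVITY OF THE (3.42) READINGS OF `kernelFamilyB` ALONG J = Σ_{y′} Δ(y′)J** (the `e_subadd` axiom of `GlobReading`), at a member with a section
`ιB` of `β`, every `B`, `cfg`, `O`, `par`, every configuration. [cite: Balaban1985BackgroundPropagators, (3.42) p.397, Thm 3.3 p.399; Balaban1984PropagatorsII, (2.52) p.232] -/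
theorem e_subadd_kernelFamilyB [Fintype (geo9Y x).Site] (ιB : BlkY x.toKIdx → IBondY x.toKIdx) (B : B9.Backgrounds) (cfg : B.Cfg → CfgY 𝔸 x.toKIdx)
    (O : BondOpY 𝔸 x.toKIdx) (par : BondParY 𝔸 x.toKIdx) (c : B.Cfg) (n : Fin 4) (J : FBondY x.toKIdx → ℝ) (y : IBondY x.toKIdx) :
    (kernelFamilyB x.toKIdx B cfg O par).e n c (.inr J) y ≤
      ∑ b : (geo9Y x).Site, (kernelFamilyB x.toKIdx B cfg O par).e n c (resB x ιB b (.inr J)) y := by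
  have hres : ∀ b : (geo9Y x).Site, resB x ιB b (.inr J) = .inr (pieceB x ιB b J) := fun b => rfl
  simp only [hres, kernelFamilyB_e_inr]
  set s := β x.toKIdx.hN x.toKIdx.D x.toKIdx.hk y
  have hbd : ∀ b : (geo9Y x).Site, ∃ C : ℝ, ∀ E : BallY 𝔸, eInB x O (cfg c) (liftY (pieceB x ιB b J) (E : 𝔸)) s n ≤ C := fun b =>
    exists_ball_bound_eInB x O (cfg c) (pieceB x ιB b J) s n
  have hsum_nonneg : 0 ≤ ∑ b : (geo9Y x).Site, ⨆ E : BallY 𝔸, eInB x O (cfg c) (liftY (pieceB x ιB b J) (E : 𝔸)) s n :=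
    Finset.sum_nonneg fun b _ => Real.iSup_nonneg fun E => eInB_nonneg x O (cfg c) _ s n
  refine Real.iSup_le (fun E => ?_) hsum_nonneg
  have hdec : liftY J (E : 𝔸) = ∑ b : (geo9Y x).Site, liftY (pieceB x ιB b J) (E : 𝔸) := by
    rw [← liftY_sumB x Finset.univ (fun b : (geo9Y x).Site => pieceB x ιB b J) (E : 𝔸), sum_pieceB x ιB J]
  rw [hdec]
  refine (eInB_sum_le x Finset.univ O (cfg c) _ s n).trans (Finset.sum_le_sum fun b _ => ?_)
  exact le_iSup_ball (A := fun E' : BallY 𝔸 => eInB x O (cfg c) (liftY (pieceB x ιB b J) (E' : 𝔸)) s n) (hbd b) E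

end Subadd

/-! ## §3 «The smallest number C such that …»: the (3.47) readings from block bounds -/

section GlobLe

variable (x : MemberY d ℓ hd hL b₀ b₁ Mstar) (ιB : BlkY x.toKIdx → IBondY x.toKIdx)

/-- ★ **THE `glob_le` AXIOM FOR `kernelFamilyB`**: if every (3.42) block reading of the bond argument `J ⊗ ·` at the labelled blocks satisfies
`e_n ≦ C·[(Lʲη)², Lʲη, Lʲη, 1]_n·(Lʲη)^γ`, then the n-th (3.47) reading is `≦ C` — every block is a labelled block (`ιB` a section of `β`) and the (3.47)
reading is the (3.41)-weighted sup of the same quantities, amplitude by amplitude (p21's `wNormBY_le_of_pointwise`).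
[cite: Balaban1985BackgroundPropagators, (3.41) p.397 («the smallest number C»), (3.47) p.398, Thm 3.3 p.399] -/
theorem glob_le_kernelFamilyB [Fintype (geo9Y x).Site] (hι : ∀ s : BlkY x.toKIdx, β x.toKIdx.hN x.toKIdx.D x.toKIdx.hk (ιB s) = s)
    (B : B9.Backgrounds) (cfg : B.Cfg → CfgY 𝔸 x.toKIdx) (O : BondOpY 𝔸 x.toKIdx) (par : BondParY 𝔸 x.toKIdx) (c : B.Cfg) (n : Fin 4)
    (J : FBondY x.toKIdx → ℝ) (γ C : ℝ) (hC : 0 ≤ C)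
    (h : ∀ y : IBondY x.toKIdx, (kernelFamilyB x.toKIdx B cfg O par).e n c (.inr J) y ≤ C * B9.pref4 ((geo9Y x).len y) n * (geo9Y x).len y ^ γ) :
    (kernelFamilyB x.toKIdx B cfg O par).glob n c (.inr J) γ ≤ C := by
  -- the inner reading at the labelled block of the fine bond `e`, below the sup over the ball, below the hypothesis
  have hKe : ∀ (e : FBondY x.toKIdx) (E : BallY 𝔸),
      eInB x O (cfg c) (liftY J (E : 𝔸)) (blkV1 x.hN x.D e) n ≤
        C * B9.pref4 ((geo9Y x).len (ιB (blkV1 x.hN x.D e))) n * (geo9Y x).len (ιB (blkV1 x.hN x.D e)) ^ γ := by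
    intro e E
    have h1 := h (ιB (blkV1 x.hN x.D e))
    rw [kernelFamilyB_e_inr, hι] at h1
    refine le_trans ?_ h1
    exact le_iSup_ball (A := fun E' : BallY 𝔸 => eInB x O (cfg c) (liftY J (E' : 𝔸)) (blkV1 x.hN x.D e) n)
      (exists_ball_bound_eInB x O (cfg c) J _ n) E
  -- the printed scale at `e`
  have hlen : ∀ e : FBondY x.toKIdx, (geo9Y x).len (ιB (blkV1 x.hN x.D e)) = ((ℓ : ℝ) + 1) ^ ((blkV1 x.hN x.D e).1.1) * |x.cf|⁻¹ :=
    len_blkB_eq x ιB hι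
  have hlen0 : ∀ e : FBondY x.toKIdx, 0 < ((ℓ : ℝ) + 1) ^ ((blkV1 x.hN x.D e).1.1) * |x.cf|⁻¹ := fun e => by
    rw [← hlen e]; exact geo9Y_len_pos x _
  revert hKe
  match n with
  | 0 =>
    intro hKe
    show (⨆ E : BallY 𝔸, wNormBY x.toKIdx (2 + γ) (O (cfg c) (liftY J (E : 𝔸)))) ≤ C
    refine Real.iSup_le (fun E => wNormBY_le_of_pointwise x.toKIdx hC fun e => ?_) hC
    have h1 : ‖O (cfg c) (liftY J (E : 𝔸)) e‖ ≤ eInB x O (cfg c) (liftY J (E : 𝔸)) (blkV1 x.hN x.D e) 0 :=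
      norm_le_supInB x.toKIdx _ _ rfl
    have h2 := hKe e E
    have hp : B9.pref4 ((geo9Y x).len (ιB (blkV1 x.hN x.D e))) 0 = (geo9Y x).len (ιB (blkV1 x.hN x.D e)) ^ 2 := rfl
    rw [hp, hlen e] at h2
    have hsplit : (((ℓ : ℝ) + 1) ^ ((blkV1 x.hN x.D e).1.1) * |x.cf|⁻¹) ^ (2 + γ) =
        (((ℓ : ℝ) + 1) ^ ((blkV1 x.hN x.D e).1.1) * |x.cf|⁻¹) ^ 2 * (((ℓ : ℝ) + 1) ^ ((blkV1 x.hN x.D e).1.1) * |x.cf|⁻¹) ^ γ := by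
      rw [Real.rpow_add (hlen0 e), Real.rpow_two]
    rw [hsplit, ← mul_assoc]
    exact h1.trans h2
  | 1 =>
    intro hKe
    show (⨆ E : BallY 𝔸, ⨆ ν : Fin (d + 1), wNormBY x.toKIdx (1 + γ) (cdB x.toKIdx (cfg c) ν (O (cfg c) (liftY J (E : 𝔸))))) ≤ C
    refine Real.iSup_le (fun E => Real.iSup_le (fun ν => wNormBY_le_of_pointwise x.toKIdx hC fun e => ?_) hC) hC
    have h1 : ‖cdB x.toKIdx (cfg c) ν (O (cfg c) (liftY J (E : 𝔸))) e‖ ≤ eInB x O (cfg c) (liftY J (E : 𝔸)) (blkV1 x.hN x.D e) 1 :=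
      (norm_le_supInB x.toKIdx _ _ rfl).trans
        (le_iSup_fin (fun ν' => supInB x.toKIdx (blkV1 x.hN x.D e) (cdB x.toKIdx (cfg c) ν' (O (cfg c) (liftY J (E : 𝔸))))) ν)
    have h2 := hKe e E
    have hp : B9.pref4 ((geo9Y x).len (ιB (blkV1 x.hN x.D e))) 1 = (geo9Y x).len (ιB (blkV1 x.hN x.D e)) := rfl
    rw [hp, hlen e] at h2
    have hsplit : (((ℓ : ℝ) + 1) ^ ((blkV1 x.hN x.D e).1.1) * |x.cf|⁻¹) ^ (1 + γ) =
        (((ℓ : ℝ) + 1) ^ ((blkV1 x.hN x.D e).1.1) * |x.cf|⁻¹) * (((ℓ : ℝ) + 1) ^ ((blkV1 x.hN x.D e).1.1) * |x.cf|⁻¹) ^ γ := by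
      rw [Real.rpow_add (hlen0 e), Real.rpow_one]
    rw [hsplit, ← mul_assoc]
    exact h1.trans h2
  | 2 =>
    intro hKe
    show (⨆ E : BallY 𝔸, ⨆ ν : Fin (d + 1), wNormBY x.toKIdx (1 + γ) (O (cfg c) (cdsB x.toKIdx (cfg c) ν (liftY J (E : 𝔸))))) ≤ C
    refine Real.iSup_le (fun E => Real.iSup_le (fun ν => wNormBY_le_of_pointwise x.toKIdx hC fun e => ?_) hC) hC
    have h1 : ‖O (cfg c) (cdsB x.toKIdx (cfg c) ν (liftY J (E : 𝔸))) e‖ ≤ eInB x O (cfg c) (liftY J (E : 𝔸)) (blkV1 x.hN x.D e) 2 :=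
      (norm_le_supInB x.toKIdx _ _ rfl).trans
        (le_iSup_fin (fun ν' => supInB x.toKIdx (blkV1 x.hN x.D e) (O (cfg c) (cdsB x.toKIdx (cfg c) ν' (liftY J (E : 𝔸))))) ν)
    have h2 := hKe e E
    have hp : B9.pref4 ((geo9Y x).len (ιB (blkV1 x.hN x.D e))) 2 = (geo9Y x).len (ιB (blkV1 x.hN x.D e)) := rfl
    rw [hp, hlen e] at h2
    have hsplit : (((ℓ : ℝ) + 1) ^ ((blkV1 x.hN x.D e).1.1) * |x.cf|⁻¹) ^ (1 + γ) =
        (((ℓ : ℝ) + 1) ^ ((blkV1 x.hN x.D e).1.1) * |x.cf|⁻¹) * (((ℓ : ℝ) + 1) ^ ((blkV1 x.hN x.D e).1.1) * |x.cf|⁻¹) ^ γ := by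
      rw [Real.rpow_add (hlen0 e), Real.rpow_one]
    rw [hsplit, ← mul_assoc]
    exact h1.trans h2
  | 3 =>
    intro hKe
    show (⨆ E : BallY 𝔸, wNormBY x.toKIdx γ (lapB x.toKIdx (cfg c) (O (cfg c) (liftY J (E : 𝔸))))) ≤ C
    refine Real.iSup_le (fun E => wNormBY_le_of_pointwise x.toKIdx hC fun e => ?_) hC
    have h1 : ‖lapB x.toKIdx (cfg c) (O (cfg c) (liftY J (E : 𝔸))) e‖ ≤ eInB x O (cfg c) (liftY J (E : 𝔸)) (blkV1 x.hN x.D e) 3 :=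
      norm_le_supInB x.toKIdx _ _ rfl
    have h2 := hKe e E
    have hp : B9.pref4 ((geo9Y x).len (ιB (blkV1 x.hN x.D e))) 3 = 1 := rfl
    rw [hp, hlen e, mul_one] at h2
    exact h1.trans h2

end GlobLe

/-! ## §4 ★★ The reading axioms and (3.47) from (3.42) for `kernelFamilyB` -/

section Main

variable (x : MemberY d ℓ hd hL b₀ b₁ Mstar) (ιB : BlkY x.toKIdx → IBondY x.toKIdx)

/-- ★★ **THE READING AXIOMS `GlobReading` HOLD FOR `kernelFamilyB` ON THE BOND ARGUMENTS**, block pieces `resB ιB`, at a member with a section `ιB` of `β`,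
every `B`, `cfg`, `O`, `par`, every configuration. [cite: Balaban1985BackgroundPropagators, (3.41)–(3.42) p.397, (3.47) p.398, Thm 3.3 p.399; Balaban1984PropagatorsII, (2.52) p.232] -/
theorem globReading_kernelFamilyB [Fintype (geo9Y x).Site] (hι : ∀ s : BlkY x.toKIdx, β x.toKIdx.hN x.toKIdx.D x.toKIdx.hk (ιB s) = s)
    (B : B9.Backgrounds) (cfg : B.Cfg → CfgY 𝔸 x.toKIdx) (O : BondOpY 𝔸 x.toKIdx) (par : BondParY 𝔸 x.toKIdx) (c : B.Cfg) :
    GlobReading (g := geo9Y x) (kernelFamilyB x.toKIdx B cfg O par) (fun lam => ∃ J, lam = Sum.inr J) c (resB x ιB) where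
  res_P := by
    rintro b lam ⟨J, rfl⟩
    exact ⟨pieceB x ιB b J, rfl⟩
  res_supp := by
    rintro b lam ⟨J, rfl⟩
    exact suppIn_pieceB x ιB hι b J
  res_norm := by
    rintro b lam γ ⟨J, rfl⟩
    exact supNorm_pieceB_le x ιB hι b J γ
  e_subadd := by
    rintro n lam y ⟨J, rfl⟩
    exact e_subadd_kernelFamilyB x ιB B cfg O par c n J y
  glob_le := by
    rintro n lam γ C ⟨J, rfl⟩ hC h
    exact glob_le_kernelFamilyB x ιB hι B cfg O par c n J γ C hC h

/-- ★★ **(3.47) FROM (3.42) FOR `kernelFamilyB`, ONE THRESHOLD PER RATE**: for every `δ₀ > 0` there are `Mg` and `Cg ≥ 0` ([4] Lemma 2.1 on the window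
`{δ₀} × [1/2, 1]` at the geometry of record with `R` read as `1`, and the size condition `8·log L ≦ δ₀·M`) such that at every member with a section of `β`
above `Mg`, for every backgrounds record, decoding, bond operator, transporter, configuration and `B₀ ≥ 0`:
`EBlock (kernelFamilyB …) B₀ δ₀ c → GlobBlock (kernelFamilyB …) (B₀·Cg) c`. [cite: Balaban1985BackgroundPropagators, (3.42) p.397, (3.47) p.398 («consequences of the local ones (3.42) and Lemma 2.1»), Thm 3.3 p.399; Balaban1984PropagatorsII, Lemma 2.1 (2.60)–(2.61) p.234] -/
theorem globBlock_kernelFamilyB_of_eBlock [∀ x : MemberY d ℓ hd hL b₀ b₁ Mstar, Fintype (geo9Y x).Site] {δ₀ : ℝ} (hδ₀ : 0 < δ₀) :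
    ∃ Mg Cg : ℝ, 0 ≤ Cg ∧
      ∀ (x : MemberY d ℓ hd hL b₀ b₁ Mstar) (ιB : BlkY x.toKIdx → IBondY x.toKIdx),
        (∀ s : BlkY x.toKIdx, β x.toKIdx.hN x.toKIdx.D x.toKIdx.hk (ιB s) = s) → Mg ≤ (geo9Y x).M →
        ∀ (B : B9.Backgrounds) (cfg : B.Cfg → CfgY 𝔸 x.toKIdx) (O : BondOpY 𝔸 x.toKIdx) (par : BondParY 𝔸 x.toKIdx) (c : B.Cfg) (B₀ : ℝ),
          0 ≤ B₀ → EBlock (kernelFamilyB x.toKIdx B cfg O par) B₀ δ₀ c → GlobBlock (kernelFamilyB x.toKIdx B cfg O par) (B₀ * Cg) c := by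
  obtain ⟨dB, ML, hW⟩ := lemma21Window_geo9Y (d := d) (ℓ := ℓ) (hd := hd) (hL := hL) (b₀ := b₀) (b₁ := b₁) (Mstar := Mstar)
    (fun _ => True) (δlo := δ₀) (δhi := δ₀) (αlo := 1 / 2) hδ₀ le_rfl (by norm_num)
  refine ⟨max ML (8 * Real.log ((ℓ : ℝ) + 1) / δ₀), B6.c1 dB δ₀ (1 - 1 / 2) * ((ℓ : ℝ) + 1) ^ (4 : ℝ),
    mul_nonneg (B6RandomWalk.c1_nonneg _ _ _) (Real.rpow_nonneg (by positivity) _), ?_⟩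
  intro x ιB hι hM B cfg O par c B₀ hB₀ hE
  have hML : ML ≤ (geo9Y x).M := le_trans (le_max_left _ _) hM
  obtain ⟨h260, h261⟩ := hW x δ₀ (1 / 2) le_rfl le_rfl le_rfl (by norm_num) hML
  have hLe : (geo9Y x).L = (ℓ : ℝ) + 1 := by show (((ℓ + 1 : ℕ) : ℝ)) = _; push_cast; rfl
  have hL1 : 1 ≤ (geo9Y x).L := geo9K_one_le_L x.toKIdx
  have hη : 0 < (geo9Y x).eta := geo9K_eta_pos x.toKIdx
  have hsize : 4 * Real.log (geo9Y x).L ≤ 1 / 2 * δ₀ * (1 : ℝ) * (geo9Y x).M := by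
    have h2 : 8 * Real.log ((ℓ : ℝ) + 1) / δ₀ ≤ (geo9Y x).M := le_trans (le_max_right _ _) hM
    rw [div_le_iff₀ hδ₀] at h2
    rw [hLe]
    linarith
  have h261' : Ineq261 dB (toB6 (geo9Y x) 1 True) δ₀ (1 - 1 / 2) := by norm_num; exact h261
  have hG := globBlockOn_of_eBlock (g := geo9Y x) (R := (1 : ℝ)) (H := True) (globReading_kernelFamilyB x ιB hι B cfg O par c) dB hB₀ hL1 hη
    (fun γ lam => geo9K_wNorm_nonneg x.toKIdx γ lam) hsize h260 h261' hE
  rw [hLe] at hG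
  intro n lam γ h1 h2
  cases lam with
  | inr J =>
    show (kernelFamilyB x.toKIdx B cfg O par).glob n c (.inr J) γ ≤
      B₀ * (B6.c1 dB δ₀ (1 - 1 / 2) * ((ℓ : ℝ) + 1) ^ (4 : ℝ)) * (geo9Y x).wNorm γ (.inr J)
    have := hG n (.inr J) γ ⟨J, rfl⟩ h1 h2
    rw [← mul_assoc]
    exact this
  | inl f =>
    have h0 : (kernelFamilyB x.toKIdx B cfg O par).glob n c (.inl f) γ = 0 := rfl
    rw [h0]
    exact mul_nonneg (mul_nonneg hB₀ (mul_nonneg (B6RandomWalk.c1_nonneg _ _ _) (Real.rpow_nonneg (by positivity) _)))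
      (geo9K_wNorm_nonneg x.toKIdx γ _)

end Main

end Literature.MathematicalPhysics.QuantumFieldTheory.Balaban1983to89.B9Ineq347BondReadingY

end
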